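/-
Copyright (c) 2026 the pub-hodgecm-mathlib formalisation cell (harness21).  Typer seat hodgecm-mathlib-typ-T5a (g0), topic T5 = P8
«(C♯)hol interior», 2026-08-31.  KERNEL module: THEOREMS ONLY (no definition, no named fact, no `sorry`, no instance, no notation).
-/
import Literature.NumberTheory.Automorphic.AutomorphicSpectrum
import Literature.NumberTheory.Automorphic.UnitaryGroupCohomologicalForms
import Literature.NumberTheory.Automorphic.UnitaryGroupAdelicProduct
import Literature.NumberTheory.Automorphic.DiscreteSummandProjection
import HarnessLib

/-!
# A discrete automorphic representation with ONE non-zero vector fixed by a NORMAL subgroup is fixed by it vector by vector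

Topic `NumberTheory/Automorphic`; namespace `Literature.NumberTheory.Automorphic`.  KERNEL: theorems only.  Cell hodgecm-mathlib FLOOR 0,
programme P2, topic T5 = P8 (`F0/P2/T5a-TREE.md` §2b: node Cc step (1) and node B step (5) = B4): the hypothesis ★
`DiscreteAutomorphicRep.IsHolCotangentAt ιinf Kc` hands the provers ONE non-zero form in `P` that is right-invariant under the compact
archimedean factor `Kc = cmCompactFactor …` (a direct factor of `U(H)(𝔸_{L⁺})`, hence a normal subgroup); what the archimedean
arguments at the definite places use is that EVERY vector of `P` is `Kc`-fixed, i.e. `P_v` is the trivial representation for `v ≠ v(ι)`.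
This is the generic representation-theoretic step:

* `ContRepresentation.ClosedSubrep.fixedVectors_eq_top_of_isTopIrreducible` — for a continuous representation `π` of `G` on a normed space,
  a topologically irreducible closed subrepresentation `W` and a NORMAL subgroup `Kc ⊴ G`: if `W^{Kc} ≠ 0` then `W^{Kc} = W`
  (`W^{Kc}` is closed — `isClosed_fixedVectors` — and `G`-stable by normality, `π(g) π(k) = π(g k g⁻¹) π(g)`;
  irreducibility = ★ `IsTopIrreducible` = `IsSimpleOrder (ClosedSubrep _)`);
* `DiscreteAutomorphicRep.rightRegular_eq_self_of_normal` — the automorphic reading: for a discrete automorphic representation `P`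
  (★ `DiscreteAutomorphicRep`: irreducible closed invariant subspace of `L²([G])`), a normal subgroup `Kc` of `G(𝔸)` and ONE non-zero
  `v₀ ∈ P` with `R(k) v₀ = v₀` for all `k ∈ Kc`, EVERY `v ∈ P` satisfies `R(k) v = v` for all `k ∈ Kc`.
* `AdelicGroupData.rightRegular_toLp_toQuotFun_eq_self_of_mul_right` — the `L²`-class of a left-`A_G G(K)`-invariant function that is
  right-invariant under `k` is FIXED by `R(k)` (★ `toQuotFun`, ★ `rightRegular`; pointwise on representatives); with the previous item,
  `DiscreteAutomorphicRep.rightRegular_eq_self_of_form`: a non-zero class in `P` of a right-`Kc`-invariant form makes all of `P` `Kc`-fixed;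
* `UnitaryGroup.normal_map_archToAdelic`, `UnitaryGroup.CotangentForms.normal_cmCompactFactor` — an archimedean normal subgroup `K_∞ ⊴ U(J)(E ⊗ ℝ)`
  stays normal in `U(J)(𝔸_F) = U(J)(E ⊗ ℝ) × U(J)(𝔸_{F,f})` (★ `adelicProdEquiv`, ★ `commute_archToAdelic_finAdelicToAdelic`); in particular the
  compact archimedean factor ★ `cmCompactFactor L ι H T hT = (ker archProjU21EmbCM).map archToAdelic` of the (C♯)hol frame is NORMAL.
* ED.2 `DiscreteAutomorphicRep.rightRegular_starProjection_of_eq_smul` — with ★ `DiscreteAutomorphicRep.starProjection_rightRegular`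
  (`DiscreteSummandProjection`: `pr_P (R(g) v) = R(g) (pr_P v)`), an `R(k)`-eigenvector CLASS `R(k) v = c • v` has an `R(k)`-eigen PROJECTION
  `R(k) (pr_P v) = c • pr_P v` — so the equivariance ∕ covariance identities of ★ `Liu2021/ThetaLiftFromLineCharacters` §6 pass to the projected
  classes `pr_P [Θ̃_Φ(f) ∘ ιA] ∈ P` (the vectors node B actually lands in `P`).
[BorelJacquet1979, §4.6]: `π ≅ ⊗' π_v`, and a factor `π_v` with a non-zero `G_v`-fixed vector, `G_v` compact and normal in `G(𝔸)`, is trivial;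
the statement here is the Hilbert-space form, with no restricted tensor product.  HC_CM is proved only modulo the printed citations until
rung 0 closes; this file discharges nothing booked.

## References
* [BorelJacquet1979] A. Borel, H. Jacquet, *Automorphic forms and automorphic representations*, PSPM 33.1 (1979), §4.6.
* [DeitmarEchterhoff2014] A. Deitmar, S. Echterhoff, *Principles of Harmonic Analysis*, 2nd ed. (2014), Thm. 7.3.2 (invariant closed
  subspaces), Lemma 7.5.? — only §7.3 is used: closed invariant subspaces of an irreducible representation are trivial.
-/

noncomputable section

open MeasureTheory NumberField
open scoped Matrix

namespace ContRepresentation.ClosedSubrep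

variable {G H : Type*} [Group G] [NormedAddCommGroup H] [NormedSpace ℂ H] {π : ContRepresentation ℂ G H}

/-- **The `Kc`-fixed vectors of a closed subrepresentation, for `Kc` NORMAL, form a closed subrepresentation** (of the representation on
`W`): `π(g)` maps `Kc`-fixed vectors to `Kc`-fixed vectors since `π(k) π(g) v = π(g) π(g⁻¹ k g) v`. [cite: BorelJacquet1979, §4.6] -/
theorem apply_mem_fixedVectors_of_normal (W : ClosedSubrep π) {Kc : Subgroup G} (hKc : Kc.Normal) (g : G)
    {v : W.toSubmodule} (hv : v ∈ W.fixedVectors Kc) : W.toContRep g v ∈ W.fixedVectors Kc := by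
  rw [mem_fixedVectors] at hv ⊢
  intro k hk
  have hk' : g⁻¹ * k * g ∈ Kc := by
    have := hKc.conj_mem k hk g⁻¹
    simpa [mul_assoc] using this
  calc W.toContRep k (W.toContRep g v) = W.toContRep (k * g) v := by
        rw [map_mul]; rfl
    _ = W.toContRep (g * (g⁻¹ * k * g)) v := by
        rw [← mul_assoc, ← mul_assoc, mul_inv_cancel, one_mul]
    _ = W.toContRep g (W.toContRep (g⁻¹ * k * g) v) := by rw [map_mul]; rfl
    _ = W.toContRep g v := by rw [hv _ hk']

omit [NormedSpace ℂ H] in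
/-- The `Kc`-fixed vectors of a closed subrepresentation form a CLOSED subspace (an intersection of equalisers of continuous maps).
[cite: BorelJacquet1979, §4.6] -/
theorem isClosed_fixedVectors [Module ℂ H] [ContinuousConstSMul ℂ H] {π : ContRepresentation ℂ G H} (W : ClosedSubrep π) (Kc : Subgroup G) :
    IsClosed (W.fixedVectors Kc : Set W.toSubmodule) := by
  have h : (W.fixedVectors Kc : Set W.toSubmodule) = ⋂ k ∈ Kc, {v | W.toContRep k v = v} := by
    ext v
    simp only [SetLike.mem_coe, mem_fixedVectors, Set.mem_iInter, Set.mem_setOf_eq]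
  rw [h]
  exact isClosed_biInter fun k _ => isClosed_eq (W.toContRep k).continuous continuous_id

/-- **For a topologically irreducible closed subrepresentation `W` and a normal subgroup `Kc`: `W^{Kc} ≠ 0 ⇒ W^{Kc} = W`.**  The fixed
vectors form a closed (`isClosed_fixedVectors`) `G`-stable (`apply_mem_fixedVectors_of_normal`) subspace of `W`, and an
irreducible `W` has no closed stable subspaces other than `0` and `W`. [cite: BorelJacquet1979, §4.6] [cite: DeitmarEchterhoff2014, Thm. 7.3.2] -/
theorem fixedVectors_eq_top_of_isTopIrreducible (W : ClosedSubrep π) (hW : W.toContRep.IsTopIrreducible) {Kc : Subgroup G}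
    (hKc : Kc.Normal) (h : W.fixedVectors Kc ≠ ⊥) : W.fixedVectors Kc = ⊤ := by
  let F : ClosedSubrep W.toContRep :=
    { toSubmodule := W.fixedVectors Kc
      apply_mem_toSubmodule := fun g v hv => W.apply_mem_fixedVectors_of_normal hKc g hv
      isClosed' := W.isClosed_fixedVectors Kc }
  have hF : F = ⊥ ∨ F = ⊤ := ((isTopIrreducible_iff _).1 hW).2 F
  rcases hF with hF | hF
  · exact absurd (congrArg (fun F' : ClosedSubrep W.toContRep => F'.toSubmodule) hF) h
  · exact congrArg (fun F' : ClosedSubrep W.toContRep => F'.toSubmodule) hF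

end ContRepresentation.ClosedSubrep

namespace Literature.NumberTheory.Automorphic

variable {K : Type} [Field K] [NumberField K] {𝒢 : AdelicGroupData.{0} K} {μ : Measure 𝒢.automorphicQuotient}
  [SMulInvariantMeasure 𝒢.Adelic 𝒢.automorphicQuotient μ]

/-- **A discrete automorphic representation containing ONE non-zero vector fixed by a normal subgroup `Kc ⊴ G(𝔸_K)` is fixed by `Kc`
vector by vector**: `R(k) v = v` for all `k ∈ Kc`, `v ∈ P` — the Hilbert-space form of «`P_v` is trivial at a place `v` where `P` has a
non-zero `G_v`-fixed vector», for `Kc` a direct (hence normal) factor such as the compact archimedean factor ★ `cmCompactFactor`.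
[cite: BorelJacquet1979, §4.6] [cite: DeitmarEchterhoff2014, Thm. 7.3.2] -/
theorem DiscreteAutomorphicRep.rightRegular_eq_self_of_normal (P : DiscreteAutomorphicRep 𝒢 μ) {Kc : Subgroup 𝒢.Adelic}
    (hKc : Kc.Normal) {v₀ : 𝒢.L2 μ} (hv₀ : v₀ ∈ P.space) (hne : v₀ ≠ 0) (hfix : ∀ k ∈ Kc, 𝒢.rightRegular μ k v₀ = v₀) :
    ∀ k ∈ Kc, ∀ v ∈ P.space, 𝒢.rightRegular μ k v = v := by
  have hmem : (⟨v₀, hv₀⟩ : P.space.toSubmodule) ∈ P.space.fixedVectors Kc := by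
    rw [ContRepresentation.ClosedSubrep.mem_fixedVectors]
    intro k hk
    exact Subtype.ext (hfix k hk)
  have hbot : P.space.fixedVectors Kc ≠ ⊥ := by
    intro hb
    rw [hb, Submodule.mem_bot] at hmem
    exact hne (by simpa using congrArg Subtype.val hmem)
  have htop := P.space.fixedVectors_eq_top_of_isTopIrreducible P.irreducible hKc hbot
  intro k hk v hv
  have hv' : (⟨v, hv⟩ : P.space.toSubmodule) ∈ P.space.fixedVectors Kc := by
    rw [htop]; exact Submodule.mem_top
  rw [ContRepresentation.ClosedSubrep.mem_fixedVectors] at hv'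
  exact congrArg Subtype.val (hv' k hk)

/-! ## ED.2 Eigen-classes have eigen-projections (★ `starProjection_rightRegular`) -/

/-- **An `R(k)`-eigenvector class has an `R(k)`-eigen projection onto `P` with the same eigenvalue**: `R(k) v = c • v ⇒ R(k) (pr_P v) = c • pr_P v`
(★ `DiscreteAutomorphicRep.starProjection_rightRegular`: `pr_P` commutes with the unitary right regular action).  Use: with ★
`Liu2021.toLp_lineThetaLift_pairRep_one_charCM` ∕ `rightRegular_toLp_lineThetaLift` the projected theta classes `pr_P [Θ̃_Φ(χ) ∘ ιA] ∈ P` inherit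
the `χ`-covariance, which is how the central character of `P` is read on `U(⟨a⟩)`. [cite: BorelJacquet1979, §4.6] [cite: Bump1997, Thm. 3.6.1 (proof, p. 342)] -/
theorem DiscreteAutomorphicRep.rightRegular_starProjection_of_eq_smul (P : DiscreteAutomorphicRep 𝒢 μ) {k : 𝒢.Adelic} {v : 𝒢.L2 μ} {c : ℂ}
    (hv : 𝒢.rightRegular μ k v = c • v) :
    𝒢.rightRegular μ k (P.space.toSubmodule.starProjection v) = c • P.space.toSubmodule.starProjection v := by
  rw [← P.starProjection_rightRegular, hv, map_smul]

/-! ## The automorphic reading: classes of right-invariant forms, and the compact archimedean factor -/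

namespace AdelicGroupData

open Literature.NumberTheory.Automorphic.UnitaryGroup.CotangentForms

/-- **The class of a right-`k`-invariant form is fixed by `R(k)`**: for `Φ : G(𝔸_K) → ℂ` left-invariant under `A_G · G(K)` (so that ★ `toQuotFun`
reads it on the quotient) with `Φ(x k) = Φ(x)` for all `x`, and its descent square-integrable, `R(k) [Φ] = [Φ]` in `L²` (`R(k)[Φ]([x]) = [Φ]([k⁻¹x])
= Φ(x⁻¹ k) = Φ(x⁻¹)`). [cite: BorelJacquet1979, §4.2 and §4.6] -/
theorem rightRegular_toLp_toQuotFun_eq_self_of_mul_right {Φ : 𝒢.Adelic → ℂ}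
    (hleft : ∀ γ ∈ 𝒢.quotientSubgroup, ∀ x, Φ (γ * x) = Φ x) {k : 𝒢.Adelic} (hright : ∀ x, Φ (x * k) = Φ x)
    (hΦ : MemLp (toQuotFun 𝒢 Φ) 2 μ) : 𝒢.rightRegular μ k (MemLp.toLp _ hΦ) = MemLp.toLp _ hΦ := by
  rw [AdelicGroupData.rightRegular_apply, DomMulAct.mk_smul_toLp]
  refine MemLp.toLp_congr _ _ (Filter.Eventually.of_forall fun q => ?_)
  obtain ⟨x, rfl⟩ := QuotientGroup.mk_surjective q
  show toQuotFun 𝒢 Φ (𝒢.toAutomorphicQuotient (k⁻¹ * x)) = toQuotFun 𝒢 Φ (𝒢.toAutomorphicQuotient x)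
  rw [toQuotFun_mk hleft, toQuotFun_mk hleft, mul_inv_rev, inv_inv, hright]

end AdelicGroupData

open Literature.NumberTheory.Automorphic.UnitaryGroup.CotangentForms in
/-- **A non-zero class in `P` of a right-`Kc`-invariant form makes `P` right-`Kc`-invariant as a whole** (`Kc` normal): the class is a non-zero
`Kc`-fixed vector of `P` (`rightRegular_toLp_toQuotFun_eq_self_of_mul_right`), and `rightRegular_eq_self_of_normal` applies.  This is the
form in which ★ `DiscreteAutomorphicRep.IsHolCotangentAt ιinf Kc` (one non-zero holomorphic cotangent form in `P`, right-`Kc`-invariant by ★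
`mem_holCotForms_iff`) yields «`P_v` is trivial at every definite place» — given that SOME coordinate class of the form is non-zero (continuity
of the form and positivity of `μ` on open sets, supplied by the consumer). [cite: BorelJacquet1979, §4.6] [cite: DeitmarEchterhoff2014, Thm. 7.3.2] -/
theorem DiscreteAutomorphicRep.rightRegular_eq_self_of_form (P : DiscreteAutomorphicRep 𝒢 μ) {Kc : Subgroup 𝒢.Adelic}
    (hKc : Kc.Normal) {Φ : 𝒢.Adelic → ℂ} (hleft : ∀ γ ∈ 𝒢.quotientSubgroup, ∀ x, Φ (γ * x) = Φ x)
    (hright : ∀ k ∈ Kc, ∀ x, Φ (x * k) = Φ x) (hΦ : MemLp (toQuotFun 𝒢 Φ) 2 μ) (hmem : MemLp.toLp _ hΦ ∈ P.space)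
    (hne : MemLp.toLp _ hΦ ≠ 0) : ∀ k ∈ Kc, ∀ v ∈ P.space, 𝒢.rightRegular μ k v = v :=
  P.rightRegular_eq_self_of_normal hKc hmem hne fun k hk =>
    AdelicGroupData.rightRegular_toLp_toQuotFun_eq_self_of_mul_right hleft (hright k hk) hΦ

namespace UnitaryGroup

variable (F E : Type) [Field F] [NumberField F] [Field E] [NumberField E] [Algebra F E] (c : E ≃ₐ[F] E) (N : ℕ)
  (J : Matrix (Fin N) (Fin N) E)

/-- **An archimedean normal subgroup stays normal in the adelic group**: for `K_∞ ⊴ U(J)(E ⊗ ℝ)`, its image `(K_∞ × 1) ≤ U(J)(𝔸_F)` under ★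
`archToAdelic` is normal — `U(J)(𝔸_F) = U(J)(E ⊗ ℝ) · U(J)(𝔸_{F,f})` (★ `archToAdelic_mul_finAdelicToAdelic`) with the two factors commuting
(★ `commute_archToAdelic_finAdelicToAdelic`), so `g (k,1) g⁻¹ = (g_∞ k g_∞⁻¹, 1)`. [cite: BorelJacquet1979, §4.1] -/
theorem normal_map_archToAdelic {Kinf : Subgroup (arch F E c N J)} (hK : Kinf.Normal) :
    (Kinf.map (archToAdelic F E c N J)).Normal := by
  refine ⟨?_⟩
  rintro _ ⟨k, hk, rfl⟩ g
  refine ⟨archPart F E c N J g * k * (archPart F E c N J g)⁻¹, hK.conj_mem k hk _, ?_⟩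
  have hc := (commute_archToAdelic_finAdelicToAdelic F E c N J k (finPart F E c N J g)).eq
  calc archToAdelic F E c N J (archPart F E c N J g * k * (archPart F E c N J g)⁻¹)
      = archToAdelic F E c N J (archPart F E c N J g) * archToAdelic F E c N J k * (archToAdelic F E c N J (archPart F E c N J g))⁻¹ := by
        rw [map_mul, map_mul, map_inv]
    _ = archToAdelic F E c N J (archPart F E c N J g) *
          (finAdelicToAdelic F E c N J (finPart F E c N J g) * archToAdelic F E c N J k *
            (finAdelicToAdelic F E c N J (finPart F E c N J g))⁻¹) *
          (archToAdelic F E c N J (archPart F E c N J g))⁻¹ := by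
        rw [← hc, mul_inv_cancel_right]
    _ = (archToAdelic F E c N J (archPart F E c N J g) * finAdelicToAdelic F E c N J (finPart F E c N J g)) * archToAdelic F E c N J k *
          (archToAdelic F E c N J (archPart F E c N J g) * finAdelicToAdelic F E c N J (finPart F E c N J g))⁻¹ := by
        simp only [mul_assoc, mul_inv_rev]
    _ = g * archToAdelic F E c N J k * g⁻¹ := by rw [archToAdelic_mul_finAdelicToAdelic]

namespace CotangentForms

/-- **The compact archimedean factor of the (C♯)hol frame is a NORMAL subgroup of `U(H)(𝔸_{L⁺})`** (★ `cmCompactFactor_eq`: the image under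
`archToAdelic` of the kernel of the projection ★ `archProjU21EmbCM` to the `ι`-factor, a normal subgroup of `U(H)(L ⊗ ℝ)`).
[cite: BorelJacquet1979, §4.1] [cite: PlatonovRapinchuk1994, §3.2 Thm 3.1] -/
theorem normal_cmCompactFactor (L : Type) [Field L] [NumberField L] [IsCMField L] (ι : L →+* ℂ) (H : Matrix (Fin 3) (Fin 3) L)
    (T : GL (Fin 3) ℂ)
    (hT : (T : Matrix (Fin 3) (Fin 3) ℂ)ᴴ * H.map ι * (T : Matrix (Fin 3) (Fin 3) ℂ) = Literature.Geometry.ComplexHyperbolic.BallModel.J) :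
    (cmCompactFactor L ι H T hT).Normal := by
  rw [cmCompactFactor_eq]
  exact normal_map_archToAdelic _ L (IsCMField.complexConj L) 3 H (MonoidHom.normal_ker _)

end CotangentForms

end UnitaryGroup

end Literature.NumberTheory.Automorphic

end
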